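import Literature.AlgebraicGeometry.Resolution.WeightedCentreFaceRing
import HarnessLib

/-!
# Weighted centres — the image of the tower storey `ρ₁^Z` consists of face isotropies (base-fixing, `≡ id mod σ`, fixing `ε_{V}`, fixing the face polynomial)

Instrument for engine 1's `W(f)` TOY MODEL (cell `pub-rosobs`, LF-MODEL-eng1-g45 §6.2 REDUCTION; CARVER-NOTES-eng1-g47 §2 (d): "image of `ρ₁` lies in
`graded w_Z 1 ⊓ baseFixing ⊓ level X 1 ⊓ fixSlots V_Z ⊓ Stab (C g_Z)`" — four of the five memberships are typed here; GRADEDNESS w.r.t. `w_Z := w ∘ Subtype.val` is left to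
carver-g67), NOT a resolution theorem and NOT about the invariant of [AbramovichTemkinWlodarczyk2024].

For `A ∈ isoFix w Z V g` and `B := restrictFace w Z V g A ∈ Aut (k[ε_{¬Z}][σ])`: `B σ = σ`, `B c = c` (`restrictFace_mem_baseFixing`), `B ≡ id (mod σ)` (`restrictFace_mem_level_one`),
`B ε_j = ε_j` for `j ∈ V ∖ Z` (`restrictFace_mem_fixSlots`), `B (g_Z) = g_Z` with `g_Z := killCompl g` the face polynomial (`restrictFace_mem_stabilizer`).

References: [Lang2002, Ch. I §3, Ch. II §1, Ch. IV §1]; [AbramovichTemkinWlodarczyk2024, §5.1 (p. 1575)].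
-/

namespace Literature.AlgebraicGeometry.Resolution.WeightedBlowup.ZKernel

open Polynomial OrderFiltration LevelProjection

variable {k : Type*} [CommRing k] {ι : Type*} {w : ι → ℚ} {Z V : Set ι} {g : MvPolynomial ι k}

/-- `ρ₁^Z A` on `C (killCompl P)` = the face class of `A (C P)` (bookkeeping). [cite: Lang2002, Ch. II §1] -/
theorem restrictFace_C_killCompl (A : isoFix w Z V g) (P : MvPolynomial ι k) :
    restrictFace w Z V g A (C (_root_.MvPolynomial.killCompl (Subtype.val_injective (p := fun j : ι => j ∉ Z)) P)) =
      faceRingEquiv Z (Ideal.Quotient.mk (slotIdeal Z) ((A : (MvPolynomial ι k)[X] ≃+* (MvPolynomial ι k)[X]) (C P))) := by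
  rw [← faceRingEquiv_mk_C, restrictFace_apply]

/-- `ρ₁^Z A` fixes the scalars (bookkeeping: `A` does). [cite: Lang2002, Ch. II §1] -/
theorem restrictFace_C_C (A : isoFix w Z V g) (c : k) :
    restrictFace w Z V g A (C (MvPolynomial.C c)) = C (MvPolynomial.C c) := by
  have h : _root_.MvPolynomial.killCompl (Subtype.val_injective (p := fun j : ι => j ∉ Z)) (MvPolynomial.C c : MvPolynomial ι k)
      = MvPolynomial.C c := MvPolynomial.algHom_C _ c
  rw [← h, restrictFace_C_killCompl, A.2.1.1.1.1.2.2 c, faceRingEquiv_mk_C]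

/-- **`ρ₁^Z A` is base-fixing** (fixes `σ` and `k`). [cite: Lang2002, Ch. II §1] -/
theorem restrictFace_mem_baseFixing (A : isoFix w Z V g) :
    restrictFace w Z V g A ∈ (baseFixing : Subgroup ((MvPolynomial {j : ι // j ∉ Z} k)[X] ≃+* (MvPolynomial {j : ι // j ∉ Z} k)[X])) :=
  ⟨restrictFace_X A, restrictFace_C_C A⟩

/-- **`ρ₁^Z A ≡ id (mod σ)`** (`A ∈ 𝔄_1` ⇒ `ρ₁^Z A ∈ 𝔄_1` of the face ring). [cite: Lang2002, Ch. IV §1] -/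
theorem restrictFace_mem_level_one (A : isoFix w Z V g) :
    restrictFace w Z V g A ∈ level (X : (MvPolynomial {j : ι // j ∉ Z} k)[X]) 1 := by
  refine mem_level_of_slots 1 (restrictFace_mem_baseFixing A) fun j => ?_
  obtain ⟨q, hq⟩ := A.2.1.1.1.2.2 (C (MvPolynomial.X j.1))
  refine ⟨faceRingEquiv Z (Ideal.Quotient.mk (slotIdeal Z) q), ?_⟩
  rw [restrictFace_C_X, hq, map_add, map_add, faceRingEquiv_mk_C,
    Literature.AlgebraicGeometry.Resolution.MvPolynomial.killCompl_X_apply, map_mul, map_mul, map_pow, map_pow, faceRingEquiv_mk_X,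
    add_sub_cancel_left]

/-- **`ρ₁^Z A` fixes the surviving slots of `V`** (`A` fixes `ε_V`). [cite: Lang2002, Ch. II §1] -/
theorem restrictFace_mem_fixSlots (A : isoFix w Z V g) :
    restrictFace w Z V g A ∈ fixSlots (k := k) (Subtype.val ⁻¹' V : Set {j : ι // j ∉ Z}) := fun j hj => by
  rw [restrictFace_C_X, A.2.1.2 j.1 hj, faceRingEquiv_mk_C, Literature.AlgebraicGeometry.Resolution.MvPolynomial.killCompl_X_apply]

/-- **`ρ₁^Z A` fixes the face polynomial `g_Z := killCompl g`** (`A` fixes `g`). [cite: Lang2002, Ch. II §1; AbramovichTemkinWlodarczyk2024, §5.1 (p. 1575)] -/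
theorem restrictFace_C_face (A : isoFix w Z V g) :
    restrictFace w Z V g A (C (_root_.MvPolynomial.killCompl (Subtype.val_injective (p := fun j : ι => j ∉ Z)) g)) =
      C (_root_.MvPolynomial.killCompl (Subtype.val_injective (p := fun j : ι => j ∉ Z)) g) := by
  rw [restrictFace_C_killCompl, show (A : (MvPolynomial ι k)[X] ≃+* (MvPolynomial ι k)[X]) (C g) = C g from MulAction.mem_stabilizer_iff.mp A.2.2,
    faceRingEquiv_mk_C]

/-- **`ρ₁^Z A` stabilises the face polynomial**, subgroup form. [cite: Lang2002, Ch. I §3, Ch. II §1] -/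
theorem restrictFace_mem_stabilizer (A : isoFix w Z V g) :
    restrictFace w Z V g A ∈ MulAction.stabilizer ((MvPolynomial {j : ι // j ∉ Z} k)[X] ≃+* (MvPolynomial {j : ι // j ∉ Z} k)[X])
      (C (_root_.MvPolynomial.killCompl (Subtype.val_injective (p := fun j : ι => j ∉ Z)) g) : (MvPolynomial {j : ι // j ∉ Z} k)[X]) :=
  MulAction.mem_stabilizer_iff.mpr (restrictFace_C_face A)

end Literature.AlgebraicGeometry.Resolution.WeightedBlowup.ZKernel
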